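import Mathlib.CategoryTheory.Limits.Shapes.Pullback.IsPullback.Basic
import Literature.AnabelianGeometry.SemiGraphs.CoveringOfObject

/-!
# The covering `𝒢_A → 𝒢` with canonical 2-cells ([SemiAnbd] Def. 2.2 (i))

Mochizuki, *Semi-graphs of anabelioids*, Publ. RIMS **42** (2006) 221–322, §2 p. 23
[cite: MochizukiSemiAnbd2006, Def. 2.2(i) p.23].  `CoveringOfObject.lean` builds `𝒢_A = BObj.coveringGraph A`
and a morphism `coveringHom A : 𝒢_A → 𝒢` whose 2-cells `φ_b` pass through Mathlib's composite
isomorphism `Over.starPullbackIsoStar`.  The GLOBAL clause of Def. 2.2 (i) — `B(𝒢_A) ≃ B(𝒢)_{/A}` with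
`φ^* ≅ (A × −)` — is proved by COMPUTING with the 2-cells, which requires their projections in closed
form.  This file therefore provides the variant `coveringHomCan A : 𝒢_A → 𝒢` with the same base and
the same vertex/edge components (`vertexHom`, `edgeHomAt`) and with 2-cells `twoIsoCan` built on

* `gluingStarIsoCan : Over.star P ⋙ (X ↦ b^* X ×_{b^* P} Q) ≅ b^* ⋙ Over.star Q`, whose component at
  `X` is THE pull-back comparison of the explicit square `isPullback_gluingStar`
  (`Q × b^* X → b^*(P × X)` is `(ι × 1)` then `b^*(P × X) ≅ b^* P × b^* X`), so that
  `gluingStarIsoCan_hom_app_left_fst/snd` give its two projections;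

plus the elementary square `isPullback_prod_map_fst` (`X × Z` is the pull-back of `Y × Z → Y ← X`).
Both `coveringHom A` and `coveringHomCan A` are finite étale coverings attached to `A`
(`CoveringOfObjectProofs.lean`).
-/

namespace Literature.AnabelianGeometry.SemiGraphs

open CategoryTheory CategoryTheory.Limits CategoryTheory.PreGaloisCategory
open Literature.AnabelianGeometry.Anabelioids

universe w' w v₁ v₂ u₁ u₂ u

-- Mathlib's `Over.pullback` / `Over.star` simp lemmas (`pullback.lift_fst`, …) only fire under the
-- pre-v4.2x defeq transparency behaviour, exactly as in `Mathlib/CategoryTheory/Comma/Over/Pullback.lean`.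
set_option backward.isDefEq.respectTransparency false

/-- `X × Z` with `(f × 1, pr₁)` is the pull-back of `pr₁ : Y × Z → Y` along `f : X → Y` (the square
underlying `Q × b^* X ≅ b^*(P × X) ×_{b^*P} Q`, [SemiAnbd] p. 23 "`b^* X ×_{b^* P} Q`").
[cite: MochizukiSemiAnbd2006, Def. 2.2(i) p.23] -/
theorem isPullback_prod_map_fst {C : Type u₁} [Category.{v₁} C] [HasPullbacks C] [HasBinaryProducts C]
    {X Y : C} (f : X ⟶ Y) (Z : C) :
    IsPullback (prod.map f (𝟙 Z)) (Limits.prod.fst : X ⨯ Z ⟶ X) (Limits.prod.fst : Y ⨯ Z ⟶ Y) f := by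
  refine IsPullback.of_iso_pullback ⟨by simp⟩
    ((pullbackProdFstIsoProd f Z).symm ≪≫ pullbackSymmetry f Limits.prod.fst) ?_ ?_
  · simp [pullbackProdFstIsoProd]
  · simp [pullbackProdFstIsoProd]

namespace SemiGraphOfAnabelioids

namespace BObj

variable {𝒢 : SemiGraphOfAnabelioids.{v₁, u₁, u}} (A : 𝒢.BObj)

/-! ### The canonical comparison `b^*(P × X) ×_{b^* P} Q ≅ Q × b^* X` -/

/-- The comparison map `Q × b^* X → b^*(P × X)`: `(ι × 1)` followed by the inverse of
`b^*(P × X) ⥲ b^* P × b^* X` (`b^*` is exact). [cite: MochizukiSemiAnbd2006, Def. 2.2(i) p.23] -/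
noncomputable def gluingStarMap {b : 𝒢.graph.Branch} {v : 𝒢.graph.Vertex} (h : 𝒢.graph.abuts b = some v)
    (P : Subobject (A.S v)) (Q : Subobject (A.T (𝒢.graph.edgeOf b))) (hle : Q ≤ A.branchImage b v h P)
    (X : 𝒢.V v) :
    (((𝒢.pull b v h).pullback ⋙ Over.star (Q : 𝒢.E (𝒢.graph.edgeOf b))).obj X).left ⟶
      ((Over.post (𝒢.pull b v h).pullback).obj ((Over.star (P : 𝒢.V v)).obj X)).left :=
  haveI : PreservesFiniteLimits (𝒢.pull b v h).pullback := (𝒢.pull b v h).property.1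
  prod.map (A.inclOfLE h P Q hle) (𝟙 ((𝒢.pull b v h).pullback.obj X)) ≫ inv (prodComparison (𝒢.pull b v h).pullback (P : 𝒢.V v) X)

/-- `gluingStarMap` followed by `b^* pr₁` is `pr₁ ≫ ι`. [cite: MochizukiSemiAnbd2006, Def. 2.2(i) p.23] -/
@[reassoc] theorem gluingStarMap_fst {b : 𝒢.graph.Branch} {v : 𝒢.graph.Vertex} (h : 𝒢.graph.abuts b = some v)
    (P : Subobject (A.S v)) (Q : Subobject (A.T (𝒢.graph.edgeOf b))) (hle : Q ≤ A.branchImage b v h P)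
    (X : 𝒢.V v) :
    A.gluingStarMap h P Q hle X ≫ (𝒢.pull b v h).pullback.map (Limits.prod.fst : (P : 𝒢.V v) ⨯ X ⟶ P) =
      Limits.prod.fst ≫ A.inclOfLE h P Q hle := by
  haveI : PreservesFiniteLimits (𝒢.pull b v h).pullback := (𝒢.pull b v h).property.1
  simp [gluingStarMap, ← prodComparison_fst]

/-- `gluingStarMap` followed by `b^* pr₂` is `pr₂`. [cite: MochizukiSemiAnbd2006, Def. 2.2(i) p.23] -/
@[reassoc] theorem gluingStarMap_snd {b : 𝒢.graph.Branch} {v : 𝒢.graph.Vertex} (h : 𝒢.graph.abuts b = some v)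
    (P : Subobject (A.S v)) (Q : Subobject (A.T (𝒢.graph.edgeOf b))) (hle : Q ≤ A.branchImage b v h P)
    (X : 𝒢.V v) :
    A.gluingStarMap h P Q hle X ≫ (𝒢.pull b v h).pullback.map (Limits.prod.snd : (P : 𝒢.V v) ⨯ X ⟶ X) = Limits.prod.snd := by
  haveI : PreservesFiniteLimits (𝒢.pull b v h).pullback := (𝒢.pull b v h).property.1
  simp [gluingStarMap, ← prodComparison_snd]

/-- Naturality of `gluingStarMap` in `X`. [cite: MochizukiSemiAnbd2006, Def. 2.2(i) p.23] -/
@[reassoc] theorem gluingStarMap_natural {b : 𝒢.graph.Branch} {v : 𝒢.graph.Vertex} (h : 𝒢.graph.abuts b = some v)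
    (P : Subobject (A.S v)) (Q : Subobject (A.T (𝒢.graph.edgeOf b))) (hle : Q ≤ A.branchImage b v h P)
    {X X' : 𝒢.V v} (u : X ⟶ X') :
    prod.map (𝟙 _) ((𝒢.pull b v h).pullback.map u) ≫ A.gluingStarMap h P Q hle X' =
      A.gluingStarMap h P Q hle X ≫ (𝒢.pull b v h).pullback.map (prod.map (𝟙 _) u) := by
  haveI : PreservesFiniteLimits (𝒢.pull b v h).pullback := (𝒢.pull b v h).property.1
  simp only [gluingStarMap, Category.assoc, prodComparison_inv_natural, prod.map_map_assoc,
    Category.id_comp, Category.comp_id, CategoryTheory.Functor.map_id]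

/-- **The comparison square**: `Q × b^* X`, with `gluingStarMap` to `b^*(P × X)` and its structure map
to `Q`, is the pull-back of `b^*(P × X) → b^* P ← Q` — i.e. `Q × b^* X ≅ b^*(P × X) ×_{b^* P} Q`
canonically (the square `(ι × 1, pr₁; b^* pr₁, ι)` transported along `b^*(P × X) ≅ b^* P × b^* X`).
[cite: MochizukiSemiAnbd2006, Def. 2.2(i) p.23] -/
theorem isPullback_gluingStar {b : 𝒢.graph.Branch} {v : 𝒢.graph.Vertex} (h : 𝒢.graph.abuts b = some v)
    (P : Subobject (A.S v)) (Q : Subobject (A.T (𝒢.graph.edgeOf b))) (hle : Q ≤ A.branchImage b v h P)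
    (X : 𝒢.V v) :
    IsPullback (A.gluingStarMap h P Q hle X)
      (((𝒢.pull b v h).pullback ⋙ Over.star (Q : 𝒢.E (𝒢.graph.edgeOf b))).obj X).hom
      ((Over.post (𝒢.pull b v h).pullback).obj ((Over.star (P : 𝒢.V v)).obj X)).hom
      (A.inclOfLE h P Q hle) := by
  haveI : PreservesFiniteLimits (𝒢.pull b v h).pullback := (𝒢.pull b v h).property.1
  have base := isPullback_prod_map_fst (A.inclOfLE h P Q hle) ((𝒢.pull b v h).pullback.obj X)
  refine base.of_iso (Iso.refl _) (asIso (prodComparison (𝒢.pull b v h).pullback (P : 𝒢.V v) X)).symm (Iso.refl _)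
    (Iso.refl _) ?_ ?_ ?_ ?_
  · rw [Iso.refl_hom, Category.id_comp]
    rfl
  · rw [Iso.refl_hom, Iso.refl_hom, Category.comp_id, Category.id_comp]
    change Limits.prod.fst = prod.lift Limits.prod.fst (𝟙 _) ≫ Limits.prod.fst
    rw [prod.lift_fst]
  · rw [Iso.refl_hom, Category.comp_id, Iso.symm_hom, asIso_inv]
    change Limits.prod.fst = inv (prodComparison (𝒢.pull b v h).pullback (P : 𝒢.V v) X) ≫
      (𝒢.pull b v h).pullback.map (prod.lift Limits.prod.fst (𝟙 _) ≫ Limits.prod.fst)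
    rw [prod.lift_fst, IsIso.eq_inv_comp, prodComparison_fst]
  · rw [Iso.refl_hom, Iso.refl_hom, Category.comp_id, Category.id_comp]

/-- First projection of the gluing functor on morphisms. [cite: MochizukiSemiAnbd2006, Def. 2.2(i) p.23] -/
@[reassoc] theorem gluingFunctor_map_left_fst {b : 𝒢.graph.Branch} {v : 𝒢.graph.Vertex}
    (h : 𝒢.graph.abuts b = some v) (P : Subobject (A.S v)) (Q : Subobject (A.T (𝒢.graph.edgeOf b)))
    (hle : Q ≤ A.branchImage b v h P) {U U' : Over (P : 𝒢.V v)} (w : U ⟶ U') :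
    ((A.gluingFunctor h P Q hle).map w).left ≫ pullback.fst _ _ = pullback.fst _ _ ≫ (𝒢.pull b v h).pullback.map w.left := by
  simp [Over.pullback_map_left]

/-- Second projection of the gluing functor on morphisms. [cite: MochizukiSemiAnbd2006, Def. 2.2(i) p.23] -/
@[reassoc] theorem gluingFunctor_map_left_snd {b : 𝒢.graph.Branch} {v : 𝒢.graph.Vertex}
    (h : 𝒢.graph.abuts b = some v) (P : Subobject (A.S v)) (Q : Subobject (A.T (𝒢.graph.edgeOf b)))
    (hle : Q ≤ A.branchImage b v h P) {U U' : Over (P : 𝒢.V v)} (w : U ⟶ U') :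
    ((A.gluingFunctor h P Q hle).map w).left ≫ pullback.snd _ _ = pullback.snd _ _ := by
  simp [Over.pullback_map_left]

/-- The core of the 2-isomorphism `φ_b`: `Over.star P ⋙ (X ↦ b^* X ×_{b^* P} Q) ≅ b^* ⋙ Over.star Q`,
CANONICALLY — the components are the pull-back comparison isomorphisms of `isPullback_gluingStar`
(so that their projections are known: `gluingStarIsoCan_hom_app_left_fst/snd`).
[cite: MochizukiSemiAnbd2006, Def. 2.2(i) p.23] -/
noncomputable def gluingStarIsoCan {b : 𝒢.graph.Branch} {v : 𝒢.graph.Vertex}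
    (h : 𝒢.graph.abuts b = some v) (P : Subobject (A.S v)) (Q : Subobject (A.T (𝒢.graph.edgeOf b)))
    (hle : Q ≤ A.branchImage b v h P) :
    Over.star (P : 𝒢.V v) ⋙ A.gluingFunctor h P Q hle ≅
      (𝒢.pull b v h).pullback ⋙ Over.star (Q : 𝒢.E (𝒢.graph.edgeOf b)) :=
  (NatIso.ofComponents
    (fun X => Over.isoMk (A.isPullback_gluingStar h P Q hle X).isoPullback
      (A.isPullback_gluingStar h P Q hle X).isoPullback_hom_snd)
    (fun {X X'} u => by
      ext
      apply pullback.hom_ext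
      · rw [Over.comp_left, Over.comp_left, Category.assoc, Category.assoc]
        erw [(A.isPullback_gluingStar h P Q hle X').isoPullback_hom_fst]
        rw [Functor.comp_map, Functor.comp_map, gluingFunctor_map_left_fst]
        erw [(A.isPullback_gluingStar h P Q hle X).isoPullback_hom_fst_assoc]
        exact A.gluingStarMap_natural h P Q hle u
      · rw [Over.comp_left, Over.comp_left, Category.assoc, Category.assoc]
        erw [(A.isPullback_gluingStar h P Q hle X').isoPullback_hom_snd]
        rw [Functor.comp_map, Functor.comp_map, gluingFunctor_map_left_snd]
        erw [(A.isPullback_gluingStar h P Q hle X).isoPullback_hom_snd]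
        exact Over.w _)).symm

/-- Components of `gluingStarIsoCan`, to `b^*(P × X)`: the inverse comparison then `gluingStarMap`
is the first projection. [cite: MochizukiSemiAnbd2006, Def. 2.2(i) p.23] -/
@[reassoc] theorem gluingStarIsoCan_hom_app_left_comp_gluingStarMap {b : 𝒢.graph.Branch}
    {v : 𝒢.graph.Vertex} (h : 𝒢.graph.abuts b = some v) (P : Subobject (A.S v))
    (Q : Subobject (A.T (𝒢.graph.edgeOf b))) (hle : Q ≤ A.branchImage b v h P) (X : 𝒢.V v) :
    ((A.gluingStarIsoCan h P Q hle).hom.app X).left ≫ A.gluingStarMap h P Q hle X = pullback.fst _ _ :=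
  (A.isPullback_gluingStar h P Q hle X).isoPullback_inv_fst

/-- Components of `gluingStarIsoCan`, to `Q`: the second projection.
[cite: MochizukiSemiAnbd2006, Def. 2.2(i) p.23] -/
@[reassoc] theorem gluingStarIsoCan_hom_app_left_fst {b : 𝒢.graph.Branch} {v : 𝒢.graph.Vertex}
    (h : 𝒢.graph.abuts b = some v) (P : Subobject (A.S v)) (Q : Subobject (A.T (𝒢.graph.edgeOf b)))
    (hle : Q ≤ A.branchImage b v h P) (X : 𝒢.V v) :
    ((A.gluingStarIsoCan h P Q hle).hom.app X).left ≫ Limits.prod.fst = pullback.snd _ _ := by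
  have e := (A.isPullback_gluingStar h P Q hle X).isoPullback_inv_snd
  change _ ≫ (prod.lift Limits.prod.fst (𝟙 _) ≫ Limits.prod.fst) = _ at e
  rw [prod.lift_fst] at e
  exact e

/-- Components of `gluingStarIsoCan`, to `b^* X`: the first projection then `b^* pr₂`.
[cite: MochizukiSemiAnbd2006, Def. 2.2(i) p.23] -/
@[reassoc] theorem gluingStarIsoCan_hom_app_left_snd {b : 𝒢.graph.Branch} {v : 𝒢.graph.Vertex}
    (h : 𝒢.graph.abuts b = some v) (P : Subobject (A.S v)) (Q : Subobject (A.T (𝒢.graph.edgeOf b)))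
    (hle : Q ≤ A.branchImage b v h P) (X : 𝒢.V v) :
    ((A.gluingStarIsoCan h P Q hle).hom.app X).left ≫ Limits.prod.snd =
      pullback.fst _ _ ≫ (𝒢.pull b v h).pullback.map (Limits.prod.snd : (P : 𝒢.V v) ⨯ X ⟶ X) := by
  rw [← gluingStarIsoCan_hom_app_left_comp_gluingStarMap, Category.assoc, gluingStarMap_snd]

/-- The CANONICAL 2-isomorphism `φ_b` of `𝒢_A → 𝒢` at the branch `(b, Q)` abutting to `(v, P)`:
`(P × −) then glue ≅ b^* then (Q × −)`, through the models, built on `gluingStarIsoCan` (same shape as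
`twoIso` of `CoveringOfObject.lean`, whose core uses Mathlib's composite `Over.starPullbackIsoStar`
instead). [cite: MochizukiSemiAnbd2006, Def. 2.2(i) p.23] -/
noncomputable def twoIsoCan (bc : A.fibreData.total.Branch) (vc : A.fibreData.total.Vertex)
    (h : A.fibreData.total.abuts bc = some vc) :
    (A.vertexHom vc).pullback ⋙ (A.coveringGraph.pull bc vc h).pullback ≅
      (𝒢.pull (A.fibreData.proj.branchMap bc) (A.fibreData.proj.vertexMap vc) (abuts_fst h)).pullback ⋙
        (A.edgeHomAt (A.fibreData.total.edgeOf bc) (𝒢.graph.edgeOf (A.fibreData.proj.branchMap bc))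
          (A.fibreData.proj.edgeOf_branchMap bc).symm).pullback :=
  let eP := Shrink.equivalence (Over ((A.vComp vc).1 : 𝒢.V (A.fibreData.proj.vertexMap vc)))
  let eQ := Shrink.equivalence
    (Over ((A.brComp bc).1 : 𝒢.E (𝒢.graph.edgeOf (A.fibreData.proj.branchMap bc))))
  let G := A.gluingFunctor (abuts_fst h) (A.vComp vc).1 (A.brComp bc).1 (brComp_le_branchImage h)
  show (Over.star _ ⋙ eP.functor) ⋙ (eP.inverse ⋙ G ⋙ eQ.functor) ≅
      (𝒢.pull (A.fibreData.proj.branchMap bc) (A.fibreData.proj.vertexMap vc) (abuts_fst h)).pullback ⋙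
        (Over.star _ ⋙ eQ.functor) from
    Functor.isoWhiskerLeft (Over.star _) (Functor.isoWhiskerRight eP.unitIso.symm (G ⋙ eQ.functor)) ≪≫
      Functor.isoWhiskerRight (A.gluingStarIsoCan (abuts_fst h) (A.vComp vc).1 (A.brComp bc).1
        (brComp_le_branchImage h)) eQ.functor

/-- **The morphism `𝒢_A → 𝒢` with canonical 2-cells** ([SemiAnbd] p. 23): over the projection
`𝔾_A → 𝔾`, with the SAME components `(𝒢_v)_P → 𝒢_v`, `(𝒢_e)_Q → 𝒢_e` as `coveringHom`
(`CoveringOfObject.lean`) and the 2-isomorphisms `twoIsoCan` — the variant used to prove the global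
clause `φ^* ≅ (A × −) ⋙ (B(𝒢)_{/A} ⥲ B(𝒢_A))`, which is a computation with the projections of the
2-cells. [cite: MochizukiSemiAnbd2006, Def. 2.2(i) p.23] -/
noncomputable def coveringHomCan : SemiGraphOfAnabelioids.Hom A.coveringGraph 𝒢 where
  base := A.fibreData.proj
  φV vc := A.vertexHom vc
  φE ec f p := A.edgeHomAt ec f p
  φB bc vc h := A.twoIsoCan bc vc h

end BObj

end SemiGraphOfAnabelioids

end Literature.AnabelianGeometry.SemiGraphs
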